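import Literature.Analysis.FluidPDE.CompressibleEulerImplosionRatesAssembly
import Literature.Analysis.FluidPDE.IsentropicEulerUniformLifespan
import Literature.Analysis.FluidPDE.CompressibleEulerLocalExistence
import HarnessLib

/-!
# The blow-up rates of non-radial periodic implosion (Cao-Labora–Gómez-Serrano–Shi–Staffilani 2025,
# Thm 1.2 / Rem. 1.5) from the self-similar profile alone

Analysis/FluidPDE proof file (theorems only; no definitions, no named facts), the last link of the
chain proving the named fact `Literature.Analysis.FluidPDE.CaolaboraEtAl2025_thm12_rates`
(`CompressibleEulerImplosionRates.lean`) modulo the one input that is genuinely outside the reach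
of the tree today, the computer-assisted existence of the smooth self-similar profile
(`Literature.Analysis.FluidPDE.BuckmasterCaolaboraGomezserrano2025_thm11_monatomic`, Buckmaster–
Cao-Labora–Gómez-Serrano 2025, Thm 1.1):

* `CompressibleEulerImplosionRatesAssembly.lean` proved the rates from the profile fact `X` and a
  QUANTITATIVE local existence statement `(LWP)` for the isentropic system (hypothesis `hLWP` of
  `CaolaboraEtAl2025.rates_of_thm11_monatomic_of_lwp`; Majda 1984, Thm 2.1 with the life span
  of its proof);
* `IsentropicEulerUniformLifespan.lean` proved `(LWP)` from the tree's local well-posedness fact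
  `CompressibleEulerLocalWellPosedness` (`IsentropicEuler.uniformLifespan_of_lwp`);
* `CompressibleEulerLocalExistence.lean` proved that fact
  (`CompressibleEulerLocalWellPosedness_holds`).

Hence `CaolaboraEtAl2025.rates_of_thm11_monatomic : X → CaolaboraEtAl2025_thm12_rates`, and the
discharge `CaolaboraEtAl2025_thm12_rates_holds` is the one-liner
`rates_of_thm11_monatomic X_holds` as soon as the profile fact is proved. (The two-hypothesis
form `X → CompressibleEulerLocalWellPosedness → CaolaboraEtAl2025_thm12_rates` is also a theorem
of the summit side, `Summit.AtomisticToContinuum.HydrodynamicLimit.Theorems.thm12_rates_of_thm11_of_lwp`,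
obtained there by a backward-in-time construction of the exterior solution; it is not restated.)

The last section records the same reduction for a profile of ANY parameter `1 < r < 2`
(`rates_of_profile_of_lwp`, `rates_of_profile`, `rates_of_exists_profile`): the numerical window of
the vendored fact plays no role, so the profiles of Shao–Wang–Wei–Zhang for `γ = 5/3`
(parameters `r_n ↑ 3 − √3`) are admissible inputs as well.

## References

* G. Cao-Labora, J. Gómez-Serrano, J. Shi, G. Staffilani, *Non-radial implosion for compressible
  Euler and Navier–Stokes in `𝕋³` and `ℝ³`*, Camb. J. Math. (2025), arXiv:2310.05325, Thm 1.2,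
  Rem. 1.4–1.5. [`CaolaboraEtAl2025`]
* T. Buckmaster, G. Cao-Labora, J. Gómez-Serrano, *Smooth imploding solutions for 3D compressible
  fluids*, Forum Math. Pi 13 (2025) e6, Thm 1.1. [`BuckmasterCaolaboraGomezserrano2025`]
* A. Majda, *Compressible Fluid Flow and Systems of Conservation Laws in Several Space
  Variables*, Springer 1984, Ch. 2 §2.1, Thms 2.1–2.2. [`Majda1984`]
* F. Shao, S. Wang, D. Wei, Z. Zhang, *Blow-up of the 3-D compressible Navier–Stokes equations for
  monatomic gases*, arXiv:2501.15701 (2025), Thm 1.1 (smooth radial self-similar profiles for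
  `γ = 5/3`, `d = 3`, `r_n ↑ 3 − √3`). [`ShaoEtAl2025`]
-/

noncomputable section

namespace Literature.Analysis.FluidPDE

namespace CaolaboraEtAl2025

/-- **The rates theorem from the profile alone** (CGSS 2025, Thm 1.2 via Rem. 1.5): since
`CompressibleEulerLocalWellPosedness` is a theorem of the tree
(`CompressibleEulerLocalWellPosedness_holds`), the blow-up rates (1.4)–(1.5) for `γ = 5/3` on `𝕋³`
follow from the existence of the smooth self-similar profile of Buckmaster–Cao-Labora–Gómez-Serrano
(`BuckmasterCaolaboraGomezserrano2025_thm11_monatomic`) and nothing else.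
[cite: CaolaboraEtAl2025, Thm 1.2, Rem. 1.5] [cite: BuckmasterCaolaboraGomezserrano2025, Thm 1.1] -/
theorem rates_of_thm11_monatomic (hX : BuckmasterCaolaboraGomezserrano2025_thm11_monatomic) :
    CaolaboraEtAl2025_thm12_rates :=
  rates_of_thm11_monatomic_of_lwp hX (IsentropicEuler.uniformLifespan_of_lwp CompressibleEulerLocalWellPosedness_holds)

/-! ### The same reduction for an arbitrary self-similar parameter `1 < r < 2`

The argument of `CompressibleEulerImplosionRatesAssembly.lean` never uses the numerical window
`1.10102 < r < 1.13476` of the vendored profile fact (Buckmaster–Cao-Labora–Gómez-Serrano's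
`(r₃(5/3), r₄(5/3))`): every step (`exists_auxData`, `lift_eq_exact_on_cone_uniform`,
`ident_annulus`, `rates_of_glue`) is stated for a smooth radial `γ = 5/3` profile with
`1 < r < 2`, `S̄ > 0` and `Ū/ζ, S̄/ζ → 0`. The two theorems below record the reduction in that
generality, so that the named fact `CaolaboraEtAl2025_thm12_rates` (whose own parameter is only
required to satisfy `1 < r`) follows from ANY such profile — in particular also from the profiles
of Shao–Wang–Wei–Zhang (arXiv:2501.15701, Thm 1.1: for `d = 3`, `γ = 5/3` a sequence of global
`C^∞` radially symmetric solutions of the same profile system with parameters `r_n ↑ 3 − √3 ≈ 1.268`,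
`S_E ≳ ⟨Z⟩^{1−r}`, `|∇ʲU_E| + |∇ʲS_E| ≲ ⟨Z⟩^{−(r−1)−j}`), which lie outside the window of the
vendored fact but inside `(1, 2)`. No new named fact is introduced: the profile is a hypothesis.
-/

open Set Filter
open scoped Topology ContDiff
open Literature.MathematicalPhysics.KineticTheory (T3 V3)
open Literature.Analysis.FunctionSpaces

/-- **The periodic implosion with its rates from a `γ = 5/3` profile of any parameter
`1 < r < 2` and a quantitative local existence theorem.** Same statement and proof as
`rates_of_thm11_monatomic_of_lwp`, with the profile clauses of
`BuckmasterCaolaboraGomezserrano2025_thm11_monatomic` as explicit hypotheses and the numerical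
window replaced by `1 < r < 2`. [cite: CaolaboraEtAl2025, Thm 1.2 p. 6, Rem 1.4 p. 6, Rem 1.5 p. 7]
[cite: ShaoEtAl2025, Thm 1.1] [cite: Majda1984, Ch. 2 Thm 2.1 + Cor. 1] -/
theorem rates_of_profile_of_lwp {r : ℝ} (hr1 : 1 < r) (hr2 : r < 2) {U S : ℝ → ℝ}
    (hU : ContDiff ℝ ∞ fun y : V3 => (U ‖y‖ / ‖y‖) • y) (hS : ContDiff ℝ ∞ fun y : V3 => S ‖y‖)
    (hode : ∀ ζ : ℝ, 0 < ζ →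
      (r - 1) * U ζ + (ζ + U ζ) * deriv U ζ + 1 / 3 * S ζ * deriv S ζ = 0 ∧
      (r - 1) * S ζ + (ζ + U ζ) * deriv S ζ + 1 / 3 * S ζ * (deriv U ζ + 2 * U ζ / ζ) = 0)
    (hSpos : ∀ ζ : ℝ, 0 ≤ ζ → 0 < S ζ)
    (hlimU : Tendsto (fun ζ => U ζ / ζ) atTop (𝓝 0))
    (hlimS : Tendsto (fun ζ => S ζ / ζ) atTop (𝓝 0))
    (hLWP : ∀ (B m : ℝ), 0 < m → ∃ τ : ℝ, 0 < τ ∧ ∀ (ρ₀ : T3 → ℝ) (u₀ : T3 → V3),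
      Torus.IsSmooth ρ₀ → Torus.IsSmooth u₀ → (∀ x, m ≤ ρ₀ x) →
      (∀ n : ℕ, n ≤ 4 → ∀ y : V3, ‖iteratedFDeriv ℝ n (Torus.lift ρ₀) y‖ ≤ B ∧
        ‖iteratedFDeriv ℝ n (Torus.lift u₀) y‖ ≤ B) →
      ∃ (ρ : ℝ → T3 → ℝ) (u : ℝ → T3 → V3),
        IsIsentropicEulerSolution (5 / 3) τ ρ u ∧ ρ 0 = ρ₀ ∧ u 0 = u₀) :
    CaolaboraEtAl2025_thm12_rates := by
  have hr0 : 0 < r := by linarith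
  set Ub : V3 → V3 := fun y => (U ‖y‖ / ‖y‖) • y with hUb
  set Sb : V3 → ℝ := fun y => S ‖y‖ with hSb
  -- `T`-uniform constants
  obtain ⟨M, hM0, hM⟩ := lift_eq_exact_on_cone_uniform hr1 hU hS hode hSpos hlimU hlimS hUb hSb
  obtain ⟨T₁, B, m, hT₁, hm, hD⟩ := exists_auxData hr1 hr2 hU hS hode hSpos hlimU hlimS hUb hSb
  obtain ⟨τ, hτ, hL⟩ := hLWP B m hm
  -- the blow-up time
  obtain ⟨T, hTdef⟩ : ∃ T : ℝ, T = min (min T₁ (τ / 2)) (min 1 ((1 / (64 * (M + 1))) ^ r)) := ⟨_, rfl⟩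
  have hT : 0 < T := by
    rw [hTdef]
    exact lt_min (lt_min hT₁ (half_pos hτ)) (lt_min one_pos (Real.rpow_pos_of_pos (by positivity) _))
  have hTT₁ : T ≤ T₁ := by rw [hTdef]; exact (min_le_left _ _).trans (min_le_left _ _)
  have hTτ : T < τ := by
    have : T ≤ τ / 2 := by rw [hTdef]; exact (min_le_left _ _).trans (min_le_right _ _)
    linarith
  have hT1 : T ≤ 1 := by rw [hTdef]; exact (min_le_right _ _).trans (min_le_left _ _)
  have hMT : M * T ^ (1 / r) ≤ 1 / 64 := by
    have h0 : T ≤ (1 / (64 * (M + 1))) ^ r := by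
      rw [hTdef]; exact (min_le_right _ _).trans (min_le_right _ _)
    have h1 : T ^ (1 / r) ≤ 1 / (64 * (M + 1)) := by
      have h := Real.rpow_le_rpow hT.le h0 (by positivity : (0 : ℝ) ≤ 1 / r)
      rw [one_div r, Real.rpow_rpow_inv (by positivity) hr0.ne'] at h
      rwa [one_div r]
    calc M * T ^ (1 / r) ≤ M * (1 / (64 * (M + 1))) := mul_le_mul_of_nonneg_left h1 hM0
      _ ≤ 1 / 64 := by
          rw [mul_one_div, div_le_div_iff₀ (by positivity) (by norm_num)]
          nlinarith
  -- the exact solution with this blow-up time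
  set u : ℝ → V3 → V3 := fun t x => (r⁻¹ * (T - t) ^ (1 / r - 1)) • Ub ((T - t) ^ (-1 / r) • x)
    with hu
  set σ : ℝ → V3 → ℝ := fun t x => (r⁻¹ * (T - t) ^ (1 / r - 1)) * Sb ((T - t) ^ (-1 / r) • x)
    with hσ
  set ρ : ℝ → V3 → ℝ := fun t x => (σ t x / 3) ^ 3 with hρ
  obtain ⟨Dρ, Du, hDρs, hDus, hDρp, hDup, hagree, hfloor, hbd⟩ :=
    hD T u σ ρ hT hTT₁ (fun _ _ => rfl) (fun _ _ => rfl) (fun _ _ => rfl)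
  -- the auxiliary periodic solution
  set ρ₀ : T3 → ℝ := Torus.descend Dρ hDρp with hρ₀
  set u₀ : T3 → V3 := Torus.descend Du hDup with hu₀
  have hl1 : Torus.lift ρ₀ = Dρ := Torus.lift_descend_holds _ _
  have hl2 : Torus.lift u₀ = Du := Torus.lift_descend_holds _ _
  have hρ₀s : Torus.IsSmooth ρ₀ := by change ContDiff ℝ ∞ (Torus.lift ρ₀); rw [hl1]; exact hDρs
  have hu₀s : Torus.IsSmooth u₀ := by change ContDiff ℝ ∞ (Torus.lift u₀); rw [hl2]; exact hDus
  have hρ₀m : ∀ x, m ≤ ρ₀ x := fun x => by rw [hρ₀, Torus.descend_apply]; exact hfloor _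
  have hbd' : ∀ n : ℕ, n ≤ 4 → ∀ y : V3, ‖iteratedFDeriv ℝ n (Torus.lift ρ₀) y‖ ≤ B ∧
      ‖iteratedFDeriv ℝ n (Torus.lift u₀) y‖ ≤ B := by
    rw [hl1, hl2]; exact hbd
  obtain ⟨ρ', u', h₂, hρ'0, hu'0⟩ := hL ρ₀ u₀ hρ₀s hu₀s hρ₀m hbd'
  have hdata : ∀ y : V3, 1 / 8 ≤ ‖y‖ → ‖y‖ ≤ 1 / 4 →
      ρ' 0 (Torus.proj y) = ρ 0 y ∧ u' 0 (Torus.proj y) = u 0 y := by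
    intro y h1 h2
    rw [hρ'0, hu'0, hρ₀, hu₀, IsentropicEuler.descend_proj, IsentropicEuler.descend_proj]
    exact hagree y h1 h2
  -- identification on the annulus, then the glued solution with its rates
  have hid := ident_annulus hM0 (hM T u σ ρ (fun _ _ => rfl) (fun _ _ => rfl) (fun _ _ => rfl))
    hMT h₂ hdata
  have hid' : ∀ t ∈ Ico 0 T, ∀ y : V3, 9 / 64 < ‖y‖ → ‖y‖ < 15 / 64 →
      ρ' t (Torus.proj y) = ρ t y ∧ u' t (Torus.proj y) = u t y :=
    fun t ht y h1 h2 => hid ⟨ht.1, ht.2.trans hTτ⟩ ht.2 y h1 h2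
  obtain ⟨ρg, ug, hsol, h2c, h3c, h4c, h5c⟩ := rates_of_glue hr1 hr2 hU hS hode hSpos hlimU hlimS
    hUb hSb hT hT1 (fun _ _ => rfl) (fun _ _ => rfl) (fun _ _ => rfl) hTτ h₂ hid'
  exact ⟨T, r, hT, hr1, ρg, ug, hsol, h2c, h3c, h4c, h5c⟩

/-- **The rates theorem from a `γ = 5/3` profile of any parameter `1 < r < 2`** (the local
existence input discharged by the tree's `CompressibleEulerLocalWellPosedness_holds` through
`IsentropicEuler.uniformLifespan_of_lwp`): a smooth radial solution `(Ū, S̄)` of the profile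
system on `ℝ³` with `S̄ > 0` on `[0, ∞)` and `Ū/ζ, S̄/ζ → 0` gives the named fact
`CaolaboraEtAl2025_thm12_rates`. With the window `1.10102 < r < 1.13476` this is
`rates_of_thm11_monatomic`; the profiles of Shao–Wang–Wei–Zhang (`r_n ↑ 3 − √3`) are also
admissible inputs. [cite: CaolaboraEtAl2025, Thm 1.2, Rem. 1.4, Rem. 1.5]
[cite: ShaoEtAl2025, Thm 1.1] [cite: BuckmasterCaolaboraGomezserrano2025, Thm 1.1] -/
theorem rates_of_profile {r : ℝ} (hr1 : 1 < r) (hr2 : r < 2) {U S : ℝ → ℝ}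
    (hU : ContDiff ℝ ∞ fun y : V3 => (U ‖y‖ / ‖y‖) • y) (hS : ContDiff ℝ ∞ fun y : V3 => S ‖y‖)
    (hode : ∀ ζ : ℝ, 0 < ζ →
      (r - 1) * U ζ + (ζ + U ζ) * deriv U ζ + 1 / 3 * S ζ * deriv S ζ = 0 ∧
      (r - 1) * S ζ + (ζ + U ζ) * deriv S ζ + 1 / 3 * S ζ * (deriv U ζ + 2 * U ζ / ζ) = 0)
    (hSpos : ∀ ζ : ℝ, 0 ≤ ζ → 0 < S ζ)
    (hlimU : Tendsto (fun ζ => U ζ / ζ) atTop (𝓝 0))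
    (hlimS : Tendsto (fun ζ => S ζ / ζ) atTop (𝓝 0)) :
    CaolaboraEtAl2025_thm12_rates :=
  rates_of_profile_of_lwp hr1 hr2 hU hS hode hSpos hlimU hlimS
    (IsentropicEuler.uniformLifespan_of_lwp CompressibleEulerLocalWellPosedness_holds)

/-- **Existential form**: any `γ = 5/3` profile with parameter in `(1, 2)` (the shape of the
vendored fact with its window widened) gives the rates fact. [cite: CaolaboraEtAl2025, Thm 1.2, Rem. 1.5] -/
theorem rates_of_exists_profile
    (h : ∃ r : ℝ, 1 < r ∧ r < 2 ∧ ∃ U S : ℝ → ℝ,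
      ContDiff ℝ ∞ (fun y : V3 => (U ‖y‖ / ‖y‖) • y) ∧
      ContDiff ℝ ∞ (fun y : V3 => S ‖y‖) ∧
      (∀ ζ : ℝ, 0 < ζ →
        (r - 1) * U ζ + (ζ + U ζ) * deriv U ζ + 1 / 3 * S ζ * deriv S ζ = 0 ∧
        (r - 1) * S ζ + (ζ + U ζ) * deriv S ζ + 1 / 3 * S ζ * (deriv U ζ + 2 * U ζ / ζ) = 0) ∧
      (∀ ζ : ℝ, 0 ≤ ζ → 0 < S ζ) ∧
      Tendsto (fun ζ => U ζ / ζ) atTop (𝓝 0) ∧ Tendsto (fun ζ => S ζ / ζ) atTop (𝓝 0)) :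
    CaolaboraEtAl2025_thm12_rates := by
  obtain ⟨r, hr1, hr2, U, S, hU, hS, hode, hSpos, hlimU, hlimS⟩ := h
  exact rates_of_profile hr1 hr2 hU hS hode hSpos hlimU hlimS

/-- Consistency check: the vendored window lies inside `(1, 2)`, so `rates_of_thm11_monatomic`
is an instance of `rates_of_exists_profile`. [cite: BuckmasterCaolaboraGomezserrano2025, Thm 1.1] -/
theorem rates_of_thm11_monatomic' (hX : BuckmasterCaolaboraGomezserrano2025_thm11_monatomic) :
    CaolaboraEtAl2025_thm12_rates := by
  obtain ⟨r, hr1, hr2, U, S, hrest⟩ := hX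
  exact rates_of_exists_profile ⟨r, by linarith, by linarith, U, S, hrest⟩

end CaolaboraEtAl2025

end Literature.Analysis.FluidPDE

end
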